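import Summits.QuantumAdvantage.QuantumAdvantage.Theorems.WbwObfuscatedGluedTreesKowRiVocabulary
import Summits.QuantumAdvantage.QuantumAdvantage.Theorems.WbwObfuscatedGluedTreesKowRiLr4RatioAux

/-!
# Stub `stub_lr4Ratio` — Luby–Rackoff for FOUR Feistel rounds (strong pseudorandomness) as a coefficient-H count
# (crux `WbwObfuscatedGluedTrees`, stmt-QuantumAdvantage-2340; line `knowledge-of-walk-split`, stage 6: real→ideal
# statistical layer)

Registered stub of the stage-6 skeleton (target `…KnowledgeOfWalkSplit.RealIdeal.IdealCodeSoundness`) over the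
stage-6 vocabulary `Theorems/WbwObfuscatedGluedTreesKowRiVocabulary.lean` §2: for the abstract four-round Feistel network
`psi` over a uniformly random key `f : LRKey a b` (four round functions between the halves `{0,1}^a` and `{0,1}^b`),
EVERY cylinder event `Cyl L` (a list of point ↦ value constraints — what a two-sided adaptive transcript of forward /
inverse queries imposes on a permutation) satisfies

  `(1 − lrSlack a b |L|) · Pr_π[Cyl L π] ≤ Pr_f[Cyl L (psi f)]`,   `lrSlack a b q = q² (2^{-a} + 2^{-b} + 2^{-(a+b)})`,

`π` a uniformly random permutation of `{0,1}^a × {0,1}^b` (Luby–Rackoff 1988, Theorem 2, in Patarin's static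
coefficient-H form).  Proof (`N = 2^a·2^b`; if no permutation meets the constraints the left side is `0`, otherwise a
permutation `π₀` meeting them turns `Cyl L` into `k ≤ |L|` constraints `x ↦ π₀ x` on the queried points):

* §1 ROUND EQUATIONS (`psi_eq_iff`): with `X = A⁰ ⊕ f₀ B⁰` (round-1 input) and `Y = B⁴ ⊕ f₃ A³` (round-4 input read
  backwards), `psi f (A⁰, B⁰) = (A³, B⁴) ↔ f₁ X = B⁰ ⊕ Y ∧ f₂ Y = X ⊕ A³`;
* §2 KEY SIDE (`key_ratio`): for the outer pairs `(f₀, f₃)` with pairwise distinct `X`'s and pairwise distinct `Y`'s the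
  constraints pin `f₁`, `f₂` at `k` distinct points each (cylinder count `LubyRackoff.card_filter_pins_mul`), and all but
  a `k(k−1)(2^{-a} + 2^{-b})` fraction of the outer pairs are such (pair collisions of the round-input map, union bound:
  `card_biUnion_coll_mul_le` of the Aux file); so `Pr_f ≥ (1 − k(k−1)(2^{-a}+2^{-b}))/N^k`;
* PERM SIDE (Aux file, `finProb_perm_prescribed`): `Pr_π = 1/(N)_k`, and `N^k (1 − k(k−1)/N) ≤ (N)_k`;
* §2 ASSEMBLY (`core_ratio4`): `s₁ + s₂ ≤ lrSlack a b q` for `s₁ = k(k−1)(2^{-a}+2^{-b})`, `s₂ = k(k−1)/N`, and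
  `(1 − s₁ − s₂)/(N)_k ≤ (1 − s₁)(1 − s₂)/(N)_k ≤ (1 − s₁)/N^k`.

The three-round one-sided analogue is `LubyRackoff.core_ratio` of `Literature/…/LubyRackoffIdealProofs.lean`, whose
counting style (cross-multiplied `Finset.filter` cards, reals only at the end) is mirrored here.
-/

set_option linter.dupNamespace false

noncomputable section

namespace Summit.QuantumAdvantage.QuantumAdvantage.Theorems.WbwObfuscatedGluedTrees.KnowledgeOfWalk.RealIdeal

open Finset
open Literature.Computability.Complexity Literature.Computability.QuantumComplexity
open Literature.Computability.QuantumComplexity.GluedTrees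
open Literature.Computability.Cryptography Literature.Computability.Cryptography.ObfuscatedGluedTrees
open Literature.Computability.Cryptography.LubyRackoff
open Summit.QuantumAdvantage.QuantumAdvantage.Theorems.WbwObfuscatedGluedTrees.KnowledgeOfWalk.BlackBox

/-! ## §1 The round equations of four Feistel rounds -/

section KeySide

variable {a b : ℕ}

/-- **The round equations**: `psi (f₀,f₁,f₂,f₃) (A⁰,B⁰) = (A³,B⁴)` iff the two INNER round functions take the
prescribed values `f₁ X = B⁰ ⊕ Y` and `f₂ Y = X ⊕ A³` at the round-1 input `X = A⁰ ⊕ f₀ B⁰` and the round-4 input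
read backwards `Y = B⁴ ⊕ f₃ A³`. [cite: LubyRackoff1988, Theorem 2 (proof)] -/
theorem psi_eq_iff (f : LRKey a b) (x y : (Fin a → Bool) × (Fin b → Bool)) :
    psi f x = y ↔
      f.2.1 (xorVec x.1 (f.1 x.2)) = xorVec x.2 (xorVec y.2 (f.2.2.2 y.1)) ∧
        f.2.2.1 (xorVec y.2 (f.2.2.2 y.1)) = xorVec (xorVec x.1 (f.1 x.2)) y.1 := by
  obtain ⟨f₀, f₁, f₂, f₃⟩ := f
  obtain ⟨A, B⟩ := x
  obtain ⟨A', B'⟩ := y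
  simp only [psi, Prod.mk.injEq]
  constructor
  · rintro ⟨hA, hB⟩
    rw [hA] at hB
    have hB2 : xorVec B (f₁ (xorVec A (f₀ B))) = xorVec B' (f₃ A') := by
      rw [← hB, xorVec_xorVec_cancel]
    refine ⟨(xorVec_eq_iff _ _ _).1 hB2, ?_⟩
    rw [hB2] at hA
    exact (xorVec_eq_iff _ _ _).1 hA
  · rintro ⟨h1, h2⟩
    have hB2 : xorVec B (f₁ (xorVec A (f₀ B))) = xorVec B' (f₃ A') := by
      rw [h1, xorVec_xorVec_cancel_left]
    rw [hB2, h2, xorVec_xorVec_cancel_left]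
    exact ⟨rfl, xorVec_xorVec_cancel _ _⟩

/-! ## §2 The coefficient-H count for four rounds over a random key

Constraints are `x ↦ g₀ x` for `x` in a finset `D` of blocks (`g₀` injective on `D`); an OUTER PAIR is
`g = (f₀, f₃)`, with round-1 inputs `X_x = x.1 ⊕ f₀ x.2` and round-4 inputs `Y_x = (g₀ x).2 ⊕ f₃ (g₀ x).1`. -/

variable (D : Finset ((Fin a → Bool) × (Fin b → Bool)))
  (g₀ : (Fin a → Bool) × (Fin b → Bool) → (Fin a → Bool) × (Fin b → Bool))

/-- **The product sets inject into the consistent keys**: summed over any set of outer pairs `(f₀, f₃)`, the numbers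
of inner pairs `(f₁, f₂)` pinned by the round equations are at most the number of keys `f` with `psi f x = g₀ x` on
`D` (the round equations suffice, `psi_eq_iff`). [cite: LubyRackoff1988, Theorem 2 (proof)] -/
theorem sum_card_cyl_le (G : Finset (((Fin b → Bool) → (Fin a → Bool)) × ((Fin a → Bool) → (Fin b → Bool)))) :
    ∑ g ∈ G,
        (univ.filter fun f₁ : (Fin a → Bool) → (Fin b → Bool) =>
            ∀ x ∈ D, f₁ (xorVec x.1 (g.1 x.2)) = xorVec x.2 (xorVec (g₀ x).2 (g.2 (g₀ x).1))).card *
          (univ.filter fun f₂ : (Fin b → Bool) → (Fin a → Bool) =>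
            ∀ x ∈ D, f₂ (xorVec (g₀ x).2 (g.2 (g₀ x).1)) = xorVec (xorVec x.1 (g.1 x.2)) (g₀ x).1).card ≤
      (univ.filter fun f : LRKey a b => ∀ x ∈ D, psi f x = g₀ x).card := by
  classical
  set cB := fun g : ((Fin b → Bool) → (Fin a → Bool)) × ((Fin a → Bool) → (Fin b → Bool)) =>
    (univ.filter fun f₁ : (Fin a → Bool) → (Fin b → Bool) =>
      ∀ x ∈ D, f₁ (xorVec x.1 (g.1 x.2)) = xorVec x.2 (xorVec (g₀ x).2 (g.2 (g₀ x).1))) with hcB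
  set cC := fun g : ((Fin b → Bool) → (Fin a → Bool)) × ((Fin a → Bool) → (Fin b → Bool)) =>
    (univ.filter fun f₂ : (Fin b → Bool) → (Fin a → Bool) =>
      ∀ x ∈ D, f₂ (xorVec (g₀ x).2 (g.2 (g₀ x).1)) = xorVec (xorVec x.1 (g.1 x.2)) (g₀ x).1) with hcC
  have hs : (G.sigma fun g => cB g ×ˢ cC g).card = ∑ g ∈ G, (cB g).card * (cC g).card := by
    rw [card_sigma]
    exact sum_congr rfl fun g _ => card_product _ _
  change ∑ g ∈ G, (cB g).card * (cC g).card ≤ _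
  rw [← hs]
  refine card_le_card_of_injOn (fun z => (z.1.1, z.2.1, z.2.2, z.1.2)) (fun z hz => ?_) (fun z _ z' _ hzz => ?_)
  · rw [mem_coe, mem_sigma, mem_product] at hz
    obtain ⟨-, hB, hC⟩ := hz
    simp only [hcB, hcC, mem_filter, mem_univ, true_and] at hB hC
    exact mem_coe.2 (mem_filter.2 ⟨mem_univ _, fun x hx => (psi_eq_iff _ x (g₀ x)).2 ⟨hB x hx, hC x hx⟩⟩)
  · obtain ⟨⟨p₀, p₃⟩, p₁, p₂⟩ := z
    obtain ⟨⟨q₀, q₃⟩, q₁, q₂⟩ := z'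
    simp only [Prod.mk.injEq] at hzz
    obtain ⟨rfl, rfl, rfl, rfl⟩ := hzz
    rfl

open scoped Classical in
/-- **Bad outer pairs** (a round-1 input collision or a round-4 input collision on `D`) lie in the union of the
pair-collision events of `f₀`, resp. of `f₃`. [cite: LubyRackoff1988, Theorem 2 (proof)] -/
theorem card_bad_le :
    (univ.filter fun g : ((Fin b → Bool) → (Fin a → Bool)) × ((Fin a → Bool) → (Fin b → Bool)) =>
        ¬ (Set.InjOn (fun x : (Fin a → Bool) × (Fin b → Bool) => xorVec x.1 (g.1 x.2)) D ∧
            Set.InjOn (fun x : (Fin a → Bool) × (Fin b → Bool) => xorVec (g₀ x).2 (g.2 (g₀ x).1)) D)).card ≤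
      (D.offDiag.biUnion fun q => univ.filter fun f₀ : (Fin b → Bool) → (Fin a → Bool) =>
          xorVec q.1.1 (f₀ q.1.2) = xorVec q.2.1 (f₀ q.2.2)).card * Fintype.card ((Fin a → Bool) → (Fin b → Bool)) +
        Fintype.card ((Fin b → Bool) → (Fin a → Bool)) *
          (D.offDiag.biUnion fun q => univ.filter fun f₃ : (Fin a → Bool) → (Fin b → Bool) =>
            xorVec (g₀ q.1).2 (f₃ (g₀ q.1).1) = xorVec (g₀ q.2).2 (f₃ (g₀ q.2).1)).card := by
  set BX := D.offDiag.biUnion fun q => univ.filter fun f₀ : (Fin b → Bool) → (Fin a → Bool) =>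
    xorVec q.1.1 (f₀ q.1.2) = xorVec q.2.1 (f₀ q.2.2) with hBX
  set BY := D.offDiag.biUnion fun q => univ.filter fun f₃ : (Fin a → Bool) → (Fin b → Bool) =>
    xorVec (g₀ q.1).2 (f₃ (g₀ q.1).1) = xorVec (g₀ q.2).2 (f₃ (g₀ q.2).1) with hBY
  have hsub : (univ.filter fun g : ((Fin b → Bool) → (Fin a → Bool)) × ((Fin a → Bool) → (Fin b → Bool)) =>
      ¬ (Set.InjOn (fun x : (Fin a → Bool) × (Fin b → Bool) => xorVec x.1 (g.1 x.2)) D ∧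
          Set.InjOn (fun x : (Fin a → Bool) × (Fin b → Bool) => xorVec (g₀ x).2 (g.2 (g₀ x).1)) D)) ⊆
      BX ×ˢ univ ∪ univ ×ˢ BY := by
    intro g hg
    rw [mem_filter, not_and_or] at hg
    rcases hg.2 with hX | hY
    · exact mem_union_left _ (mem_product.2
        ⟨mem_biUnion_coll_of_not_injOn D (fun x : (Fin a → Bool) × (Fin b → Bool) => x) g.1 hX, mem_univ _⟩)
    · exact mem_union_right _ (mem_product.2 ⟨mem_univ _,
        mem_biUnion_coll_of_not_injOn D (fun x : (Fin a → Bool) × (Fin b → Bool) => ((g₀ x).2, (g₀ x).1)) g.2 hY⟩)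
  calc _ ≤ (BX ×ˢ univ ∪ univ ×ˢ BY).card := card_le_card hsub
    _ ≤ (BX ×ˢ (univ : Finset ((Fin a → Bool) → (Fin b → Bool)))).card +
          ((univ : Finset ((Fin b → Bool) → (Fin a → Bool))) ×ˢ BY).card := card_union_le _ _
    _ = BX.card * Fintype.card ((Fin a → Bool) → (Fin b → Bool)) +
          Fintype.card ((Fin b → Bool) → (Fin a → Bool)) * BY.card := by
        rw [card_product, card_product, card_univ, card_univ]

/-- **The coefficient-H lower bound for four rounds over a random key** (Luby–Rackoff's count): for `k` constraints
`x ↦ g₀ x`, `x ∈ D`, `g₀` injective on `D`, `Pr_f[psi f x = g₀ x on D] ≥ (1 − k(k−1)(2^{-a} + 2^{-b})) / N^k` with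
`N = 2^a · 2^b`: all but a `k(k−1)(2^{-a} + 2^{-b})` fraction of the outer pairs are good (`card_bad_le`,
`card_biUnion_coll_mul_le`), and for a good outer pair the round equations pin `f₁`, `f₂` at `k` distinct points each
(`LubyRackoff.card_filter_pins_mul`). [cite: LubyRackoff1988, Theorem 2] -/
theorem key_ratio (hg : Set.InjOn g₀ D) :
    (1 - (D.card : ℝ) * ((D.card : ℝ) - 1) * (1 / 2 ^ a + 1 / 2 ^ b)) / (2 ^ a * 2 ^ b) ^ D.card ≤
      finProb (PMF.uniformOfFintype (LRKey a b)) (fun f => ∀ x ∈ D, psi f x = g₀ x) := by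
  classical
  set k := D.card with hkdef
  set PA : ℝ := 2 ^ a with hPAdef
  set PB : ℝ := 2 ^ b with hPBdef
  have hPA : (Fintype.card (Fin a → Bool) : ℝ) = PA := by
    rw [Fintype.card_fun, Fintype.card_bool, Fintype.card_fin]; push_cast; rfl
  have hPB : (Fintype.card (Fin b → Bool) : ℝ) = PB := by
    rw [Fintype.card_fun, Fintype.card_bool, Fintype.card_fin]; push_cast; rfl
  have hPApos : 0 < PA := by rw [hPAdef]; positivity
  have hPBpos : 0 < PB := by rw [hPBdef]; positivity
  set cBA : ℝ := (Fintype.card ((Fin b → Bool) → (Fin a → Bool)) : ℝ) with hcBA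
  set cAB : ℝ := (Fintype.card ((Fin a → Bool) → (Fin b → Bool)) : ℝ) with hcAB
  have hcBApos : 0 < cBA := by rw [hcBA]; exact_mod_cast Fintype.card_pos
  have hcABpos : 0 < cAB := by rw [hcAB]; exact_mod_cast Fintype.card_pos
  set e : ℝ := (k : ℝ) * ((k : ℝ) - 1) with hedef
  have hoff : (D.offDiag.card : ℝ) = e := by
    rw [offDiag_card, Nat.cast_sub (Nat.le_mul_self D.card), hedef]; push_cast; ring
  set Dk : ℝ := (PA * PB) ^ k with hDkdef
  have hDkpos : 0 < Dk := by rw [hDkdef]; positivity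
  -- the good outer pairs
  set G := (univ.filter fun g : ((Fin b → Bool) → (Fin a → Bool)) × ((Fin a → Bool) → (Fin b → Bool)) =>
    Set.InjOn (fun x : (Fin a → Bool) × (Fin b → Bool) => xorVec x.1 (g.1 x.2)) D ∧
      Set.InjOn (fun x : (Fin a → Bool) × (Fin b → Bool) => xorVec (g₀ x).2 (g.2 (g₀ x).1)) D) with hGdef
  -- (1) at least `|G| · (cAB / PB^k) · (cBA / PA^k)` consistent keys
  have hK : (G.card : ℝ) * ((cAB / PB ^ k) * (cBA / PA ^ k)) ≤
      (univ.filter fun f : LRKey a b => ∀ x ∈ D, psi f x = g₀ x).card := by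
    have hs' := sum_card_cyl_le D g₀ G
    have hs : (∑ g ∈ G,
        ((univ.filter fun f₁ : (Fin a → Bool) → (Fin b → Bool) =>
            ∀ x ∈ D, f₁ (xorVec x.1 (g.1 x.2)) = xorVec x.2 (xorVec (g₀ x).2 (g.2 (g₀ x).1))).card : ℝ) *
          (univ.filter fun f₂ : (Fin b → Bool) → (Fin a → Bool) =>
            ∀ x ∈ D, f₂ (xorVec (g₀ x).2 (g.2 (g₀ x).1)) = xorVec (xorVec x.1 (g.1 x.2)) (g₀ x).1).card) ≤
        (univ.filter fun f : LRKey a b => ∀ x ∈ D, psi f x = g₀ x).card := by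
      exact_mod_cast hs'
    have hterm : ∀ g ∈ G,
        ((univ.filter fun f₁ : (Fin a → Bool) → (Fin b → Bool) =>
            ∀ x ∈ D, f₁ (xorVec x.1 (g.1 x.2)) = xorVec x.2 (xorVec (g₀ x).2 (g.2 (g₀ x).1))).card : ℝ) *
          (univ.filter fun f₂ : (Fin b → Bool) → (Fin a → Bool) =>
            ∀ x ∈ D, f₂ (xorVec (g₀ x).2 (g.2 (g₀ x).1)) = xorVec (xorVec x.1 (g.1 x.2)) (g₀ x).1).card =
        (cAB / PB ^ k) * (cBA / PA ^ k) := by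
      intro g hgG
      rw [hGdef, mem_filter] at hgG
      obtain ⟨-, hX, hY⟩ := hgG
      have hBn : (univ.filter fun f₁ : (Fin a → Bool) → (Fin b → Bool) =>
          ∀ x ∈ D, f₁ (xorVec x.1 (g.1 x.2)) = xorVec x.2 (xorVec (g₀ x).2 (g.2 (g₀ x).1))).card *
            Fintype.card (Fin b → Bool) ^ k = Fintype.card ((Fin a → Bool) → (Fin b → Bool)) := by
        convert card_filter_pins_mul D (fun x : (Fin a → Bool) × (Fin b → Bool) => xorVec x.1 (g.1 x.2))
          (fun x => xorVec x.2 (xorVec (g₀ x).2 (g.2 (g₀ x).1))) hX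
      have hCn : (univ.filter fun f₂ : (Fin b → Bool) → (Fin a → Bool) =>
          ∀ x ∈ D, f₂ (xorVec (g₀ x).2 (g.2 (g₀ x).1)) = xorVec (xorVec x.1 (g.1 x.2)) (g₀ x).1).card *
            Fintype.card (Fin a → Bool) ^ k = Fintype.card ((Fin b → Bool) → (Fin a → Bool)) := by
        convert card_filter_pins_mul D
          (fun x : (Fin a → Bool) × (Fin b → Bool) => xorVec (g₀ x).2 (g.2 (g₀ x).1))
          (fun x => xorVec (xorVec x.1 (g.1 x.2)) (g₀ x).1) hY
      have hB : ((univ.filter fun f₁ : (Fin a → Bool) → (Fin b → Bool) =>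
          ∀ x ∈ D, f₁ (xorVec x.1 (g.1 x.2)) = xorVec x.2 (xorVec (g₀ x).2 (g.2 (g₀ x).1))).card : ℝ) *
            PB ^ k = cAB := by
        rw [← hPB, hcAB]
        exact_mod_cast hBn
      have hC : ((univ.filter fun f₂ : (Fin b → Bool) → (Fin a → Bool) =>
          ∀ x ∈ D, f₂ (xorVec (g₀ x).2 (g.2 (g₀ x).1)) = xorVec (xorVec x.1 (g.1 x.2)) (g₀ x).1).card : ℝ) *
            PA ^ k = cBA := by
        rw [← hPA, hcBA]
        exact_mod_cast hCn
      rw [(eq_div_iff (by positivity)).2 hB, (eq_div_iff (by positivity)).2 hC]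
    rw [sum_congr rfl hterm, sum_const, nsmul_eq_mul] at hs
    exact hs
  -- (2) at least `cBA · cAB · (1 − e (1/PA + 1/PB))` good outer pairs
  have hG : cBA * cAB * (1 - e * (1 / PA + 1 / PB)) ≤ G.card := by
    set BX := D.offDiag.biUnion fun q => univ.filter fun f₀ : (Fin b → Bool) → (Fin a → Bool) =>
      xorVec q.1.1 (f₀ q.1.2) = xorVec q.2.1 (f₀ q.2.2) with hBX
    set BY := D.offDiag.biUnion fun q => univ.filter fun f₃ : (Fin a → Bool) → (Fin b → Bool) =>
      xorVec (g₀ q.1).2 (f₃ (g₀ q.1).1) = xorVec (g₀ q.2).2 (f₃ (g₀ q.2).1) with hBY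
    have hu : Set.InjOn (fun x : (Fin a → Bool) × (Fin b → Bool) => ((g₀ x).2, (g₀ x).1))
        (D : Set ((Fin a → Bool) × (Fin b → Bool))) := by
      intro x hx x' hx' h
      simp only [Prod.mk.injEq] at h
      exact hg hx hx' (Prod.ext h.2 h.1)
    have hBXle : (BX.card : ℝ) * PA ≤ e * cBA := by
      rw [← hPA, ← hoff, hcBA]
      exact_mod_cast card_biUnion_coll_mul_le D (fun x : (Fin a → Bool) × (Fin b → Bool) => x)
        (Function.injective_id.injOn)
    have hBYle : (BY.card : ℝ) * PB ≤ e * cAB := by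
      rw [← hPB, ← hoff, hcAB]
      exact_mod_cast card_biUnion_coll_mul_le D (fun x : (Fin a → Bool) × (Fin b → Bool) => ((g₀ x).2, (g₀ x).1)) hu
    have hGc : (((univ.filter fun g : ((Fin b → Bool) → (Fin a → Bool)) × ((Fin a → Bool) → (Fin b → Bool)) =>
        ¬ (Set.InjOn (fun x : (Fin a → Bool) × (Fin b → Bool) => xorVec x.1 (g.1 x.2)) D ∧
            Set.InjOn (fun x : (Fin a → Bool) × (Fin b → Bool) => xorVec (g₀ x).2 (g.2 (g₀ x).1)) D)).card : ℕ) : ℝ) ≤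
        BX.card * cAB + cBA * BY.card := by
      rw [hcAB, hcBA]
      exact_mod_cast card_bad_le D g₀
    have hcc : (G.card : ℝ) +
        ((univ.filter fun g : ((Fin b → Bool) → (Fin a → Bool)) × ((Fin a → Bool) → (Fin b → Bool)) =>
          ¬ (Set.InjOn (fun x : (Fin a → Bool) × (Fin b → Bool) => xorVec x.1 (g.1 x.2)) D ∧
              Set.InjOn (fun x : (Fin a → Bool) × (Fin b → Bool) => xorVec (g₀ x).2 (g.2 (g₀ x).1)) D)).card : ℕ) =
        cBA * cAB := by
      rw [hcBA, hcAB, ← Nat.cast_mul, ← Fintype.card_prod, ← Finset.card_univ, hGdef]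
      exact_mod_cast card_filter_add_card_filter_not _
    have hx : (BX.card : ℝ) ≤ e * cBA / PA := by rw [le_div_iff₀ hPApos]; exact hBXle
    have hy : (BY.card : ℝ) ≤ e * cAB / PB := by rw [le_div_iff₀ hPBpos]; exact hBYle
    have hGc' := hGc.trans (show (BX.card : ℝ) * cAB + cBA * BY.card ≤ e * cBA / PA * cAB + cBA * (e * cAB / PB) by
      gcongr)
    have heq : cBA * cAB * (1 - e * (1 / PA + 1 / PB)) =
        cBA * cAB - (e * cBA / PA * cAB + cBA * (e * cAB / PB)) := by
      ring
    linarith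
  -- (3) the probability
  have hL : (Fintype.card (LRKey a b) : ℝ) = cBA * cAB * cBA * cAB := by
    rw [hcBA, hcAB]
    simp only [LRKey, Fintype.card_prod]
    push_cast
    ring
  rw [finProb_uniform, hL]
  calc (1 - e * (1 / PA + 1 / PB)) / Dk = cBA * cAB * (1 - e * (1 / PA + 1 / PB)) / (cBA * cAB * Dk) := by
        field_simp
    _ ≤ (G.card : ℝ) / (cBA * cAB * Dk) := div_le_div_of_nonneg_right hG (by positivity)
    _ = (G.card : ℝ) * ((cAB / PB ^ k) * (cBA / PA ^ k)) / (cBA * cAB * cBA * cAB) := by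
        rw [hDkdef, mul_pow]
        field_simp
    _ ≤ _ := div_le_div_of_nonneg_right hK (by positivity)

/-- **The cylinder ratio on finsets**: for `k ≤ q` constraints `x ↦ g₀ x` (`g₀` injective on `D`) with
`lrSlack a b q < 1`, `(1 − lrSlack a b q) · Pr_π[π = g₀ on D] ≤ Pr_f[psi f = g₀ on D]`: with
`s₁ = k(k−1)(2^{-a}+2^{-b})`, `s₂ = k(k−1)/N`, one has `s₁ + s₂ ≤ lrSlack a b q`, `Pr_π = 1/(N)_k`
(`finProb_perm_prescribed`), `N^k (1 − s₂) ≤ (N)_k` (`toolkit_riLr4RatioAux`), `Pr_f ≥ (1 − s₁)/N^k` (`key_ratio`),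
and `(1 − s₁ − s₂)/(N)_k ≤ (1 − s₁)(1 − s₂)/(N)_k ≤ (1 − s₁)/N^k`. [cite: LubyRackoff1988, Theorem 2]
[cite: Patarin2009, Thm. 3 (p. 329)] -/
theorem core_ratio4 (hg : Set.InjOn g₀ D) {q : ℕ} (hq : D.card ≤ q) (hlr : 0 < 1 - lrSlack a b q) :
    (1 - lrSlack a b q) *
        finProb (PMF.uniformOfFintype (Equiv.Perm ((Fin a → Bool) × (Fin b → Bool)))) (fun π => ∀ x ∈ D, π x = g₀ x) ≤
      finProb (PMF.uniformOfFintype (LRKey a b)) (fun f => ∀ x ∈ D, psi f x = g₀ x) := by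
  classical
  set k := D.card with hkdef
  set Nr : ℝ := 2 ^ a * 2 ^ b with hNrdef
  have hNrpos : 0 < Nr := by rw [hNrdef]; positivity
  have hNnat : Fintype.card ((Fin a → Bool) × (Fin b → Bool)) = 2 ^ a * 2 ^ b := by
    simp [Fintype.card_prod]
  have hN : (Fintype.card ((Fin a → Bool) × (Fin b → Bool)) : ℝ) = Nr := by
    rw [hNnat, hNrdef]; push_cast; ring
  have hkN : k ≤ Fintype.card ((Fin a → Bool) × (Fin b → Bool)) := card_le_univ D
  set e : ℝ := (k : ℝ) * ((k : ℝ) - 1) with hedef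
  set s₁ : ℝ := e * (1 / 2 ^ a + 1 / 2 ^ b) with hs₁def
  set s₂ : ℝ := e / Nr with hs₂def
  have he0 : 0 ≤ e := cast_mul_pred_nonneg k
  have heq : e ≤ (q : ℝ) ^ 2 := by
    have hq1 : (q : ℝ) * ((q : ℝ) - 1) ≤ (q : ℝ) ^ 2 := by nlinarith [Nat.cast_nonneg (α := ℝ) q]
    exact (cast_mul_pred_le hq).trans hq1
  have hs : s₁ + s₂ ≤ lrSlack a b q := by
    have hsum : s₁ + s₂ = e * (1 / 2 ^ a + 1 / 2 ^ b + 1 / 2 ^ (a + b)) := by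
      rw [hs₁def, hs₂def, hNrdef, pow_add]; ring
    rw [hsum, lrSlack]
    exact mul_le_mul_of_nonneg_right heq (by positivity)
  have hs1 : 0 ≤ s₁ := by rw [hs₁def]; positivity
  have hs2 : 0 ≤ s₂ := by rw [hs₂def]; positivity
  -- the permutation side
  set Dn : ℝ := ((Fintype.card ((Fin a → Bool) × (Fin b → Bool))).descFactorial k : ℝ) with hDndef
  have hperm : finProb (PMF.uniformOfFintype (Equiv.Perm ((Fin a → Bool) × (Fin b → Bool))))
      (fun π => ∀ x ∈ D, π x = g₀ x) = 1 / Dn :=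
    finProb_perm_prescribed D g₀ hg
  have hDge : Nr ^ k * (1 - s₂) ≤ Dn := by
    have h := toolkit_riLr4RatioAux (Fintype.card ((Fin a → Bool) × (Fin b → Bool))) k hkN
    rw [hN] at h
    rw [hs₂def, hedef, hDndef]
    convert h using 2
  have h1s2 : 0 < 1 - s₂ := by linarith
  have h1s1 : 0 ≤ 1 - s₁ := by linarith
  have hNk : 0 < Nr ^ k * (1 - s₂) := mul_pos (pow_pos hNrpos k) h1s2
  have hDpos : 0 < Dn := lt_of_lt_of_le hNk hDge
  -- the key side
  have hkey : (1 - s₁) / Nr ^ k ≤ finProb (PMF.uniformOfFintype (LRKey a b)) (fun f => ∀ x ∈ D, psi f x = g₀ x) := by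
    have h := key_ratio D g₀ hg
    rw [hs₁def, hedef, hNrdef]
    convert h using 2
  rw [hperm]
  calc (1 - lrSlack a b q) * (1 / Dn) ≤ (1 - s₁ - s₂) / Dn := by
        rw [mul_one_div]
        exact div_le_div_of_nonneg_right (by linarith) hDpos.le
    _ ≤ (1 - s₁) * (1 - s₂) / Dn := div_le_div_of_nonneg_right (by nlinarith) hDpos.le
    _ ≤ (1 - s₁) * (1 - s₂) / (Nr ^ k * (1 - s₂)) :=
        div_le_div_of_nonneg_left (mul_nonneg h1s1 h1s2.le) hNk hDge
    _ = (1 - s₁) / Nr ^ k := by field_simp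
    _ ≤ _ := hkey

end KeySide

/-! ## §3 The registered stub -/

/-- **Stub `stub_lr4Ratio`** (Luby–Rackoff 1988, Theorem 2 — four Feistel rounds with independent random round
functions are a STRONG pseudorandom permutation — in the static coefficient-H form): for every list `L` of
point ↦ value constraints (what any two-sided transcript of forward/inverse queries imposes on a permutation),
`(1 − lrSlack a b |L|) · Pr_π[Cyl L π] ≤ Pr_f[Cyl L (psi f)]` for `π` a uniformly random permutation of
`{0,1}^a × {0,1}^b` and `f` a uniformly random key of four round functions.  Trivial when the slack is `≥ 1` or when no
permutation meets the constraints; otherwise, for a permutation `π₀` meeting them, `Cyl L g ↔ g = π₀` on the `≤ |L|`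
queried points, and `core_ratio4` applies. [cite: LubyRackoff1988, Theorem 2] [cite: Patarin2009, Thm. 3 (p. 329)] -/
theorem stub_lr4Ratio : ∀ (a b : ℕ)
    (L : List (((Fin a → Bool) × (Fin b → Bool)) × ((Fin a → Bool) × (Fin b → Bool)))),
    (1 - lrSlack a b L.length) *
        finProb (PMF.uniformOfFintype (Equiv.Perm ((Fin a → Bool) × (Fin b → Bool)))) (fun π => Cyl L π) ≤
      finProb (PMF.uniformOfFintype (LRKey a b)) (fun f => Cyl L (psi f)) := by
  classical
  intro a b L
  by_cases hlr : 1 - lrSlack a b L.length ≤ 0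
  · exact (mul_nonpos_of_nonpos_of_nonneg hlr (finProb_nonneg _ _)).trans (finProb_nonneg _ _)
  push Not at hlr
  by_cases hex : ∃ π : Equiv.Perm ((Fin a → Bool) × (Fin b → Bool)), Cyl L π
  swap
  · have h0 : finProb (PMF.uniformOfFintype (Equiv.Perm ((Fin a → Bool) × (Fin b → Bool)))) (fun π => Cyl L π) = 0 := by
      rw [finProb_uniform, filter_eq_empty_iff.2 fun π _ h => hex ⟨π, h⟩, card_empty, Nat.cast_zero, zero_div]
    rw [h0, mul_zero]
    exact finProb_nonneg _ _
  obtain ⟨π₀, hπ₀⟩ := hex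
  -- the queried points and the reference permutation
  set D := (L.map Prod.fst).toFinset with hD
  have hcyl : ∀ g : (Fin a → Bool) × (Fin b → Bool) → (Fin a → Bool) × (Fin b → Bool),
      Cyl L g ↔ ∀ x ∈ D, g x = π₀ x := by
    intro g
    constructor
    · intro h x hx
      obtain ⟨p, hp, rfl⟩ := List.mem_map.1 (List.mem_toFinset.1 hx)
      rw [h p hp, hπ₀ p hp]
    · intro h p hp
      rw [h p.1 (List.mem_toFinset.2 (List.mem_map.2 ⟨p, hp, rfl⟩)), hπ₀ p hp]
  have hDq : D.card ≤ L.length := (List.toFinset_card_le _).trans (by rw [List.length_map])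
  rw [finProb_congr _ fun π : Equiv.Perm ((Fin a → Bool) × (Fin b → Bool)) => hcyl π,
    finProb_congr _ fun f : LRKey a b => hcyl (psi f)]
  exact core_ratio4 D π₀ π₀.injective.injOn hDq hlr

end Summit.QuantumAdvantage.QuantumAdvantage.Theorems.WbwObfuscatedGluedTrees.KnowledgeOfWalk.RealIdeal

end
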